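import Summits.HodgeConjecture.HodgeConjecture.Theses.HolomorphicityRate
import Summits.HodgeConjecture.HodgeConjecture.Theorems.HolomorphicityRateSuperThresholdRigidityOfHodgeBelowMiddle
import Summits.HodgeConjecture.HodgeConjecture.Theorems.HolomorphicityRateRateGapOfHodgeMiddle
import Summits.HodgeConjecture.HodgeConjecture.Theorems.HolomorphicityRateAnalyticSupportAlgebraic
import Summits.HodgeConjecture.HodgeConjecture.Theorems.HolomorphicityRateTargetOfCruxes
import Summits.HodgeConjecture.HodgeConjecture.Theorems.HolomorphicityRateTargetSuffices
import HarnessLib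

/-!
# Route `HolomorphicityRate`: the two cruxes are jointly the summit — certificates (lead c3 of crux R2)

Crux item `stmt-HodgeConjecture-2737` (`HolomorphicityRate.SuperThresholdRigidity`, R2) and its sister
`stmt-HodgeConjecture-10762` (`HolomorphicityRate.RateGap`, R1). The route's deciding theorem is
`closes : RateGap → SuperThresholdRigidity → AnalyticSupportAlgebraic → HodgeModelsExist → HodgeConjecture`;
both support hypotheses are theorems of the tree (`analyticSupportAlgebraic_proof`, Chow/GAGA;
`nonempty_hodgeModel_holds`, Serre GAGA + Hodge decomposition). Conversely the leads of the two crux lines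
landed `rateGap_of_hodgeConjecture` (HC ⟹ R1, cancellation on the ray over a holomorphic cycle support) and
`superThresholdRigidity_of_hodgeConjecture` (E2 ∧ HC ⟹ R2, rational Thom line + GAGA supports), where E2 is
the route's threshold lemma `ThresholdForcesHodgeType` (support item stmt-HodgeConjecture-10764).

This file records the resulting kernel-checked CERTIFICATES, so that the status of the route can be read
off one accepted theorem each:

* `hodgeConjecture_of_rateGap_of_superThresholdRigidity` — R1 ∧ R2 ⟹ HC with the two support items
  discharged (unconditional);
* `rateGap_iff_hodgeConjecture_of_superThresholdRigidity` — granted R2, the crux R1 is EQUIVALENT to the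
  summit (unconditional);
* `rateGap_and_superThresholdRigidity_iff_hodgeConjecture` — granted E2, the PAIR of cruxes is equivalent
  to the summit;
* `superThresholdRigidity_iff_hodgeConjecture_of_rateGap`,
  `superThresholdRigidity_iff_hodgeBelowMiddle_of_rateGap` — granted E2 and R1, the crux R2 is equivalent
  to the summit, equivalently (by `hodgeConjecture_iff_hodgeBelowMiddle`) to the one open registered stub
  `stub_hodgeBelowMiddle` of its line `registered` (the Hodge conjecture for rational `(p,p)` classes,
  `2 ≤ p ≤ n/2`).

Reading: as filed, neither crux isolates the "rate" mechanism of the card — each one, granted the other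
(and E2 for R2), is the whole summit; the residual open content of both registered lines is the same
statement `stub_hodgeBelowMiddle` ≃ `_root_.HodgeConjecture`.

## References

* P. Deligne, *The Hodge conjecture*, Clay problem description (2000), §1. [Deligne2000]
* C. Voisin, *Hodge Theory and Complex Algebraic Geometry I* (2002), Thm. 11.30, §11.1.2. [VoisinHodgeI2002]
* J.-P. Serre, *Géométrie algébrique et géométrie analytique* (1956), §2 n°5, §6 Prop. 3. [SerreGAGA1956]
-/

noncomputable section

-- `Summit.HodgeConjecture.HodgeConjecture.Theorems` is the mandated namespace (single-conjunct summit: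
-- Sub = Summit), which `linter.dupNamespace` flags; the lakefile turns the linter off tree-wide.
set_option linter.dupNamespace false

namespace Summit.HodgeConjecture.HodgeConjecture.Theorems

open Summit.HodgeConjecture.HodgeConjecture.Theses.HolomorphicityRate
open Literature.AlgebraicGeometry.HodgeTheory Literature.AlgebraicGeometry.Motives

/-- **R1 ∧ R2 ⟹ HC, supports discharged.** The route's deciding theorem `closes` with its two support
hypotheses supplied by the tree: `AnalyticSupportAlgebraic` (`analyticSupportAlgebraic_proof`, Chow/GAGA) and
`HodgeModelsExist` (`nonempty_hodgeModel_holds`). [cite: Deligne2000, §1] [cite: SerreGAGA1956, §2 n°5] -/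
theorem hodgeConjecture_of_rateGap_of_superThresholdRigidity (hR1 : RateGap) (hR2 : SuperThresholdRigidity) :
    _root_.HodgeConjecture :=
  -- the route's `closes` was re-cut (rev 5, carrier split: 7 new hypotheses); the former chain
  -- R1 → R2 → Target → Statement is the two landed supports `TargetOfCruxes` and `TargetSuffices`
  TargetSuffices_proof (holomorphicityRate_targetOfCruxes_proof hR1 hR2) analyticSupportAlgebraic_proof
    fun _ _ hX => nonempty_hodgeModel_holds hX

/-- **Granted R2, the crux R1 (`RateGap`) is equivalent to the summit** — unconditionally: `→` is
`hodgeConjecture_of_rateGap_of_superThresholdRigidity`, `←` is the landed `rateGap_of_hodgeConjecture`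
(an irreducible holomorphic cycle support of `m•c + a•hᵖ` has defect `0`). [cite: Deligne2000, §1] -/
theorem rateGap_iff_hodgeConjecture_of_superThresholdRigidity (hR2 : SuperThresholdRigidity) :
    RateGap ↔ _root_.HodgeConjecture :=
  ⟨fun hR1 => hodgeConjecture_of_rateGap_of_superThresholdRigidity hR1 hR2, rateGap_of_hodgeConjecture⟩

/-- **Granted the threshold lemma E2, the pair of cruxes (R1, R2) is equivalent to the summit.**
`→`: `closes` with discharged supports; `←`: `rateGap_of_hodgeConjecture` and
`superThresholdRigidity_of_hodgeConjecture hE2` (E2 pins the Hodge type of `c`, the rational Thom line and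
the Hodge conjecture make the ray class algebraic, GAGA supports it analytically). [cite: Deligne2000, §1]
[cite: VoisinHodgeI2002, §11.1.2] -/
theorem rateGap_and_superThresholdRigidity_iff_hodgeConjecture (hE2 : ThresholdForcesHodgeType) :
    (RateGap ∧ SuperThresholdRigidity) ↔ _root_.HodgeConjecture :=
  ⟨fun h => hodgeConjecture_of_rateGap_of_superThresholdRigidity h.1 h.2,
    fun hHC => ⟨rateGap_of_hodgeConjecture hHC, superThresholdRigidity_of_hodgeConjecture hE2 hHC⟩⟩

/-- **Granted E2 and R1, the crux R2 (`SuperThresholdRigidity`) is equivalent to the summit.**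
[cite: Deligne2000, §1] [cite: VoisinHodgeI2002, §11.1.2] -/
theorem superThresholdRigidity_iff_hodgeConjecture_of_rateGap (hE2 : ThresholdForcesHodgeType)
    (hR1 : RateGap) : SuperThresholdRigidity ↔ _root_.HodgeConjecture :=
  ⟨fun hR2 => hodgeConjecture_of_rateGap_of_superThresholdRigidity hR1 hR2,
    superThresholdRigidity_of_hodgeConjecture hE2⟩

/-- **Granted E2 and R1, the crux R2 is equivalent to the one open registered stub of its line**
`stub_hodgeBelowMiddle` (the Hodge conjecture for rational `(p,p)` classes with `2 ≤ p ≤ n/2` on smooth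
projective `n`-folds), through `hodgeConjecture_iff_hodgeBelowMiddle`. This is the certificate behind the
ledger flag `skeleton.hides_summit` on crux stmt-HodgeConjecture-2737. [cite: Deligne2000, §1]
[cite: VoisinHodgeI2002, Thm. 11.30] -/
theorem superThresholdRigidity_iff_hodgeBelowMiddle_of_rateGap : Summit.HodgeConjecture.HodgeConjecture.Theses.HolomorphicityRate.ThresholdForcesHodgeType → Summit.HodgeConjecture.HodgeConjecture.Theses.HolomorphicityRate.RateGap → (Summit.HodgeConjecture.HodgeConjecture.Theses.HolomorphicityRate.SuperThresholdRigidity ↔ ∀ (n p : ℕ) (X : Literature.AlgebraicGeometry.Motives.SchemeOver ℂ), Literature.AlgebraicGeometry.Motives.IsSmoothProjective n X → 2 ≤ p → 2 * p ≤ n → ∀ (A : Literature.AlgebraicGeometry.HodgeTheory.HodgeModel n X) (c : Literature.AlgebraicGeometry.HodgeTheory.complexBetti X (2 * p)), Literature.AlgebraicGeometry.HodgeTheory.IsRationalClass c → A.pullback (2 * p) c ∈ A.hodgePQ (2 * p) p p → c ∈ Literature.AlgebraicGeometry.HodgeTheory.algebraicClasses X p) :=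
  fun hE2 hR1 => (superThresholdRigidity_iff_hodgeConjecture_of_rateGap hE2 hR1).trans hodgeConjecture_iff_hodgeBelowMiddle

/-- **Without R1: E2 ∧ (stub C) ⟹ R2 and R1 ∧ R2 ⟹ (stub C)** — the two one-sided facts that hold with no
hypothesis on the sister crux, packaged: the stub `stub_hodgeBelowMiddle` implies the crux granted E2
(`superThresholdRigidity_of_hodgeBelowMiddle`), and the two cruxes together imply the stub
(`hodgeConjecture_of_rateGap_of_superThresholdRigidity`, then specialisation). [cite: Deligne2000, §1] -/
theorem hodgeBelowMiddle_of_rateGap_of_superThresholdRigidity (hR1 : RateGap) (hR2 : SuperThresholdRigidity) :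
    ∀ (n p : ℕ) (X : Literature.AlgebraicGeometry.Motives.SchemeOver ℂ), Literature.AlgebraicGeometry.Motives.IsSmoothProjective n X → 2 ≤ p → 2 * p ≤ n → ∀ (A : Literature.AlgebraicGeometry.HodgeTheory.HodgeModel n X) (c : Literature.AlgebraicGeometry.HodgeTheory.complexBetti X (2 * p)), Literature.AlgebraicGeometry.HodgeTheory.IsRationalClass c → A.pullback (2 * p) c ∈ A.hodgePQ (2 * p) p p → c ∈ Literature.AlgebraicGeometry.HodgeTheory.algebraicClasses X p :=
  hodgeConjecture_iff_hodgeBelowMiddle.1 (hodgeConjecture_of_rateGap_of_superThresholdRigidity hR1 hR2)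

end Summit.HodgeConjecture.HodgeConjecture.Theorems

end
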